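import Literature.NumberTheory.EllipticCurves.GreenbergVatsal2000.GreenbergSelmerGroups
import Literature.NumberTheory.EllipticCurves.H1CorestrictionIndexTwo
import Literature.NumberTheory.EllipticCurves.PeriodIndexCorestrictionLocal
import Literature.NumberTheory.EllipticCurves.SubgroupSelmerCocycleCriteriaProofs
import Literature.NumberTheory.EllipticCurves.SelmerGroupOverTorsionFinite
import Literature.NumberTheory.GaloisRepresentations.DecompositionGroupOfCompletion
import Literature.NumberTheory.GaloisRepresentations.IntegralGaloisActionProofs
import Literature.NumberTheory.GaloisRepresentations.AbsGaloisOuterConj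
import Literature.NumberTheory.Automorphic.AdicCompletionLocalField
import HarnessLib

/-!
# Greenberg–Vatsal's classes unramified outside `S₀ ∪ {p}` die on EVERY inertia group `I_𝔓 ∩ H`,
# `𝔓 ∣ v ∉ S₀ ∪ {p}`, and form a FINITE set when the coefficient module is finite (Silverman X.4.3)

Topic `NumberTheory/EllipticCurves`, sub-directory `GreenbergVatsal2000` (namespace = path).  THEOREMS ONLY
(no definition, no named fact, no instance, no `sorry`).  Written by a prover seat of the cell `bsd-wall`
(route `ResidualThetaTransportAtTwo`, crux RSL_g stmt-BirchSwinnertonDyer-22608, stub-plan rev 14 Q59 /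
card `stub-cmlambdalower-k3-g10` item H-E = FIN_ρ): the ONE dialect lemma between the tree's two ways of
saying "unramified at `v`" —

* Greenberg–Vatsal's `unramifiedOutside H M p S₀ ⊆ H¹(H, M)` (`GreenbergSelmerGroups.lean`): for every
  finite `v ∉ S₀` with `v ∤ p` and EVERY `σ ∈ Γ_K`, `conj_σ c` dies on the inertia group `H ⊓ I_v` of the
  CHOSEN prime `𝔓₀ = adicCompletionPrime K v` (GV p. 16: `H¹(K_Σ/K_∞, A)`, all places of `L = K̄^H` over
  `v` at once via the conjugates);
* Silverman X.4.3 at level `H` (`finite_setOf_resOfLe_inertia_inf_eq_zero`, `SelmerGroupOverTorsionFinite.lean`):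
  classes dying on `I_𝔓 ⊓ H` for EVERY prime `𝔓` of `\bar ℤ_K` over `v ∉ S`.

Main statements (any number field `K`, `H ⊴ Γ_K`, discrete `Γ_K`-module `M`):
* `conjH1_oneCocycleClass_mem_unramifiedKer_iff` — the cocycle criterion for `conj_σ [z] ∈ unramifiedKer H M v`
  (Literature copy of the two-line Summits lemma of `EisensteinPrimesUnramifiedOutsideRamification`);
* `resOfLe_inertia_inf_eq_zero_of_mem_unramifiedOutside` — **`c ∈ unramifiedOutside H M p S₀`,
  `v ∉ S₀`, `v ∤ p`, `𝔓 ∣ v` ⟹ `res_{I_𝔓 ⊓ H} c = 0`**: write `𝔓 = ρ₀ • 𝔓₀`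
  (`exists_smul_eq_of_mem_primesAbove_holds`), apply the GV condition to `σ = ρ₀⁻¹`, and transport the
  coboundary along `x ↦ ρ₀⁻¹ x ρ₀ : I_𝔓 ∩ H → I_{𝔓₀} ∩ H` (`conj_mem_inertia_smul`,
  `inertia_adicCompletionPrime_eq_map_absInertia`): `z(x) = x • (ρ₀ a) − ρ₀ a`;
* `finite_setOf_mem_unramifiedOutside` — **for `M` FINITE (continuous action) and `H` OPEN, the set
  `unramifiedOutside H M p S₀` is finite** whenever `S₀` is finite and `p ≠ 0` (Silverman, AEC Lemma X.4.3
  "`H¹(G_{K̄/K}, M; S)` is finite", at level `H`, with `S = S₀ ∪ {v ∣ p}`).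

HONEST FRAMING: folklore bookkeeping; nothing here is specific to BSD; BSD is not proved by any of this.

References: R. Greenberg, V. Vatsal, Invent. Math. 142 (2000), §2 pp. 16–17, 23 [GreenbergVatsal2000];
J. H. Silverman, *The Arithmetic of Elliptic Curves* (2009), Lemma X.4.3 [SilvermanAEC2009]; J. Neukirch,
*Algebraic Number Theory* (1999), Ch. I §9 (9.1), Ch. II §9 (9.6) [NeukirchANT1999]; J.-P. Serre,
*Galois Cohomology* (1997), I §2.5, I §5.1 [SerreGaloisCohomology1997].
-/

noncomputable section

open scoped NumberField Pointwise
open Field IsDedekindDomain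
open Literature.NumberTheory.GaloisRepresentations
open Literature.NumberTheory.EllipticCurves Literature.NumberTheory.EllipticCurves.GreenbergSelmer

universe u

namespace Literature.NumberTheory.EllipticCurves.GreenbergVatsal2000

variable {K : Type} [Field K] [NumberField K]

section Module

variable (H : Subgroup (absoluteGaloisGroup K)) [H.Normal]
variable (M : Type) [AddCommGroup M] [DistribMulAction (absoluteGaloisGroup K) M] [TopologicalSpace M]
  [DiscreteTopology M]
variable (p : ℕ) (S₀ : Set (HeightOneSpectrum (𝓞 K)))

/-- The cocycle criterion for `unramifiedKer` after conjugation: `conj_σ [z] ∈ unramifiedKer H M v` iff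
`y ↦ σ • z(σ⁻¹ y σ)` is principal on `H ⊓ I_v` (Literature copy of the Summits lemma of the same name in
`Theorems/EisensteinPrimesUnramifiedOutsideRamification`). [cite: SerreGaloisCohomology1997, I §5.1]
[cite: GreenbergVatsal2000, §2 p. 17] -/
theorem conjH1_oneCocycleClass_mem_unramifiedKer_iff (v : HeightOneSpectrum (𝓞 K)) (σ : absoluteGaloisGroup K)
    (z : contOneCocycles (discreteTopRep H M)) :
    conjH1 H M σ (oneCocycleClass _ z) ∈ unramifiedKer H M v ↔
      ∃ a : M, ∀ y : inertiaIn H v,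
        σ • z.1 (subgroupConj H σ (inertiaInToH H v y)) = ((y : decomp (K := K) v) : absoluteGaloisGroup K) • a - a := by
  rw [unramifiedKer, AddMonoidHom.mem_ker, conjH1_oneCocycleClass, resH1Hom_oneCocycleClass, oneCocycleClass_eq_zero_iff]
  rfl

variable {H M p S₀}

/-- **A Greenberg–Vatsal class unramified outside `S₀ ∪ {p}` dies on EVERY inertia group `I_𝔓 ∩ H`,
`𝔓 ∣ v`, `v ∉ S₀`, `v ∤ p`** (not only on the chosen `I_{𝔓₀}`): `𝔓 = ρ₀ • 𝔓₀` for some `ρ₀ ∈ Γ_K`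
(transitivity on the primes over `v`), the GV condition at `σ = ρ₀⁻¹` says `ρ₀⁻¹ • z(ρ₀ y ρ₀⁻¹) = y • a − a`
on `H ∩ I_{𝔓₀}`, and `x ↦ y = ρ₀⁻¹ x ρ₀` maps `I_𝔓 ∩ H` into `I_{𝔓₀} ∩ H` (`H` normal), whence
`z(x) = x • (ρ₀ a) − ρ₀ a`. [cite: GreenbergVatsal2000, §2 pp. 16–17] [cite: NeukirchANT1999, Ch. I §9 Prop. (9.1)] -/
theorem resOfLe_inertia_inf_eq_zero_of_mem_unramifiedOutside {c : subgroupH1 H M}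
    (hc : c ∈ unramifiedOutside H M p S₀) {v : HeightOneSpectrum (𝓞 K)} (hv : v ∉ S₀)
    (hvp : ((p : ℕ) : 𝓞 K) ∉ v.asIdeal) {𝔓 : Ideal (absIntegers (𝓞 K) K)} (h𝔓 : 𝔓 ∈ v.primesAbove) :
    resOfLe M (inf_le_right : 𝔓.inertia (absoluteGaloisGroup K) ⊓ H ≤ H) c = 0 := by
  classical
  obtain ⟨z, rfl⟩ := oneCocycleClass_surjective _ c
  -- `𝔓 = ρ₀ • 𝔓₀`
  obtain ⟨ρ₀, hρ₀⟩ := HeightOneSpectrum.exists_smul_eq_of_mem_primesAbove_holds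
    (adicCompletionPrime_mem_primesAbove K v) h𝔓
  -- the GV condition for the conjugate `ρ₀⁻¹`
  have h1 := (mem_unramifiedOutside_iff _).mp hc v hv hvp ρ₀⁻¹
  rw [conjH1_oneCocycleClass_mem_unramifiedKer_iff] at h1
  obtain ⟨a, ha⟩ := h1
  rw [CocycleCriteria.resOfLe_oneCocycleClass_eq_zero_iff]
  refine ⟨ρ₀ • a, fun x => ?_⟩
  have hxI : (x : absoluteGaloisGroup K) ∈ 𝔓.inertia (absoluteGaloisGroup K) := x.2.1
  have hxH : (x : absoluteGaloisGroup K) ∈ H := x.2.2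
  -- `y = ρ₀⁻¹ x ρ₀ ∈ H ∩ I_{𝔓₀}`
  have hyI : ρ₀⁻¹ * (x : absoluteGaloisGroup K) * ρ₀ ∈ GreenbergSelmer.inertia v := by
    rw [GreenbergSelmer.inertia, ← inertia_adicCompletionPrime_eq_map_absInertia]
    refine (Ideal.conj_mem_inertia_smul_iff (adicCompletionPrime K v) ρ₀ _).mp ?_
    rw [hρ₀, show ρ₀ * (ρ₀⁻¹ * (x : absoluteGaloisGroup K) * ρ₀) * ρ₀⁻¹ = (x : absoluteGaloisGroup K) by group]
    exact hxI
  have hyD : ρ₀⁻¹ * (x : absoluteGaloisGroup K) * ρ₀ ∈ GreenbergSelmer.decomp v :=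
    GreenbergSelmer.inertia_le_decomp v hyI
  have hyH : ρ₀⁻¹ * (x : absoluteGaloisGroup K) * ρ₀ ∈ H := Subgroup.Normal.conj_mem' inferInstance _ hxH ρ₀
  let y : inertiaIn H v := ⟨⟨ρ₀⁻¹ * (x : absoluteGaloisGroup K) * ρ₀, hyD⟩, (mem_inertiaIn_iff H v _).2 ⟨hyH, hyI⟩⟩
  have key := ha y
  -- `ρ₀⁻¹⁻¹ (ρ₀⁻¹ x ρ₀) ρ₀⁻¹ = x`
  have e : subgroupConj H ρ₀⁻¹ (inertiaInToH H v y) = Subgroup.inclusion inf_le_right x := by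
    apply Subtype.ext
    rw [subgroupConj_apply_coe]
    change ρ₀⁻¹⁻¹ * (ρ₀⁻¹ * (x : absoluteGaloisGroup K) * ρ₀) * ρ₀⁻¹ = (x : absoluteGaloisGroup K)
    group
  rw [e] at key
  change ρ₀⁻¹ • z.1 (Subgroup.inclusion inf_le_right x) = (ρ₀⁻¹ * (x : absoluteGaloisGroup K) * ρ₀) • a - a at key
  have key' := congrArg (fun m : M => ρ₀ • m) key
  dsimp only at key'
  rw [smul_inv_smul, smul_sub, ← mul_smul,
    show ρ₀ * (ρ₀⁻¹ * (x : absoluteGaloisGroup K) * ρ₀) = (x : absoluteGaloisGroup K) * ρ₀ by group, mul_smul] at key'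
  exact key'

/-- The finite places of `K` containing a given non-zero natural number form a finite set (the prime
factors of `(n)`, Mathlib `Ideal.finite_factors`; private helper). [folklore] -/
private theorem finite_setOf_natCast_mem_asIdeal {n : ℕ} (hn : n ≠ 0) :
    {v : HeightOneSpectrum (𝓞 K) | ((n : ℕ) : 𝓞 K) ∈ v.asIdeal}.Finite := by
  have hn' : ((n : ℕ) : 𝓞 K) ≠ 0 := by exact_mod_cast hn
  refine (Ideal.finite_factors (I := Ideal.span {((n : ℕ) : 𝓞 K)}) ?_).subset fun v hv => ?_
  · rwa [Ne, Ideal.zero_eq_bot, Ideal.span_singleton_eq_bot]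
  · change v.asIdeal ∣ Ideal.span {((n : ℕ) : 𝓞 K)}
    rw [Ideal.dvd_span_singleton]
    exact hv

/-- **Greenberg–Vatsal's `H¹(K_Σ/L, M)`, `Σ = S₀ ∪ {p, ∞}`, is FINITE for a finite module `M` and `L = K̄^H` with
`H` open** (Silverman, AEC Lemma X.4.3 "Let `M` be a finite `G_{K̄/K}`-module … `H¹(G_{K̄/K}, M; S)` is
finite", at level `H`: the tree's `finite_setOf_resOfLe_inertia_inf_eq_zero`, fed by
`resOfLe_inertia_inf_eq_zero_of_mem_unramifiedOutside` with `S = S₀ ∪ {v ∣ p}`). [cite: SilvermanAEC2009, Lemma X.4.3]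
[cite: GreenbergVatsal2000, §2 pp. 16, 23] -/
theorem finite_setOf_mem_unramifiedOutside [Finite M] [ContinuousSMul (absoluteGaloisGroup K) M]
    (hH : IsOpen (H : Set (absoluteGaloisGroup K))) (hp : p ≠ 0) (hS₀ : S₀.Finite) :
    {c : subgroupH1 H M | c ∈ unramifiedOutside H M p S₀}.Finite := by
  refine (finite_setOf_resOfLe_inertia_inf_eq_zero H hH
    (S := S₀ ∪ {v | ((p : ℕ) : 𝓞 K) ∈ v.asIdeal}) (hS₀.union (finite_setOf_natCast_mem_asIdeal hp))).subset ?_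
  intro c hc v hvS 𝔓 h𝔓
  exact resOfLe_inertia_inf_eq_zero_of_mem_unramifiedOutside hc (fun h => hvS (Or.inl h))
    (fun h => hvS (Or.inr h)) h𝔓

end Module

end Literature.NumberTheory.EllipticCurves.GreenbergVatsal2000

end
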